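import Summits.AnomalousDissipation.AnomalousDissipation.Theorems.SawtoothPulseCascadeK1LocalisedCascadeAffineProfileCascade
import Summits.AnomalousDissipation.AnomalousDissipation.Theorems.SawtoothPulseCascadeK1LocalisedCascadeStripCutoff
import Literature.Analysis.FluidPDE.ShearStageTransport

/-!
# K1loc, line `Spectral` / SeqCone — helper: THE FLAT-STRIP DATA OF THE CASCADE CUT-OFFS (S-B assembly, cascade socket 1)

Helper file of the prover lane on the crux `K1LocalisedCascade` (stmt-AnomalousDissipation-19491), route
`SawtoothPulseCascade`.  The generic S-B assembly (`…MultiplierBundle`, `…FibreData`, `…FibreSocket`) consumes, per strip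
family `σ = ±1` of phase `j`, the FLAT-STRIP DATA of the un-gauging multiplier: a set `U` on which the exact-flat un-gauging
profile `P = γŨ_j` has constant slope `s = σγ`, off which the strip cut-off `X^σ_j` vanishes locally, and `|X^σ_j| ≤ 1`.
This file supplies it:
* `flatStrip_data` — GENERIC: for a continuous slope field `V`, a cut-off `X(y) = sT((σV(y) − (1−2ε))/ε)` and a profile `Ũ`
  with `Ũ′ = σ` wherever `σV ≥ 1 − δ` (`2ε < δ`), the set `U = {σV > 1 − δ}` works for `P = c·Ũ` with `s = cσ`;
* `cascade_flatStrip_data_pos` / `_neg` — the cascade instance: `V = U_j′`, `Ũ_j = affinizeU` of `…AffineProfileCascade` with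
  threshold `δ = 3ε` (`hasDerivAt_affinizeU_of_ge/_of_le`: slope EXACTLY `±1` where `±U_j′ ≥ 1 − 3ε`), `X^±_j` the strip cut-offs
  of `…StripCutoff`, `P = amp Ũ_j γ`, `s = ±γ` — in the hypothesis shapes `hPU`, `hXU`, `hX1` of
  `…K1Ledger.exists_multiplier_bundle` / `fibre_estimate_of_profile_data`.
No definitions (the profiles are passed as `ShearProfile`s characterised pointwise); no statement about the stub.
[cite: Grafakos2014, Prop. 3.1.2 (5)] [problem: turb]
-/

-- `Summit.<Summit>.<Problem>`: single-conjunct summit, the duplicate namespace segment is deliberate.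
set_option linter.dupNamespace false

noncomputable section

namespace Summit.AnomalousDissipation.AnomalousDissipation.Theorems.SawtoothPulseCascade.K1Ledger

open Set Filter Topology Real
open scoped ContDiff
open Literature.Analysis Literature.Analysis.FunctionSpaces Literature.Analysis.FunctionSpaces.Torus
open Literature.Analysis.FluidPDE.ShearStage
open Literature.Analysis.FluidPDE.SawtoothCascade Literature.Analysis.FluidPDE.SawtoothCascade.CascadeParams
open Summit.AnomalousDissipation.AnomalousDissipation.Theorems.SawtoothPulseCascade.K1Cutoff

/-! ## §1 Generic flat-strip data -/

/-- **Flat-strip data of a strip cut-off.**  Let `V` be continuous, `0 < ε`, `2ε < δ`, `σ ∈ ℝ`; let the profile `Q` be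
`c·Ũ` pointwise where `Ũ′ = σ` wherever `1 − δ ≤ σV`, and let the cut-off profile `X` be `sT((σV − (1−2ε))/ε)` pointwise.  Then
with `U = {y | 1 − δ < σV(y)}`: `Q′ = cσ` on `U`, `X` vanishes locally (as a complex function) off `U`, and `|X| ≤ 1`.
[cite: Grafakos2014, Prop. 3.1.2 (5)] -/
theorem flatStrip_data {V Ut : ℝ → ℝ} (hV : Continuous V) {σ δ ε : ℝ} (hε : 0 < ε) (h2ε : 2 * ε < δ)
    (hUt : ∀ y, 1 - δ ≤ σ * V y → HasDerivAt Ut σ y) (c : ℝ) (Q : ShearProfile) (hQ : ∀ y, Q y = c * Ut y)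
    (X : ShearProfile) (hX : ∀ y, X y = smoothTransition ((σ * V y - (1 - 2 * ε)) / ε)) :
    (∀ y ∈ {y : ℝ | 1 - δ < σ * V y}, HasDerivAt Q (c * σ) y) ∧
      (∀ y, y ∉ {y : ℝ | 1 - δ < σ * V y} → (fun y : ℝ => (X y : ℂ)) =ᶠ[𝓝 y] 0) ∧ (∀ y, |X y| ≤ 1) := by
  refine ⟨fun y hy => ?_, fun y hy => ?_, fun y => ?_⟩
  · have hQf : (Q : ℝ → ℝ) = fun y => c * Ut y := funext hQ
    rw [hQf]
    exact (hUt y (le_of_lt hy)).const_mul c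
  · -- `σV ≤ 1 − δ < 1 − 2ε` at `y`, hence `σV < 1 − 2ε` nearby, where the cut-off vanishes
    have hy' : σ * V y ≤ 1 - δ := not_lt.1 hy
    have hopen : IsOpen {z : ℝ | σ * V z < 1 - 2 * ε} := isOpen_lt (continuous_const.mul hV) continuous_const
    have hmem : y ∈ {z : ℝ | σ * V z < 1 - 2 * ε} := by
      show σ * V y < 1 - 2 * ε
      linarith
    filter_upwards [hopen.mem_nhds hmem] with z hz
    have hz' : σ * V z < 1 - 2 * ε := hz
    rw [Pi.zero_apply, hX z, smoothTransition.zero_of_nonpos (div_nonpos_of_nonpos_of_nonneg (by linarith) hε.le),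
      Complex.ofReal_zero]
  · rw [hX y]; exact abs_cutoff_le_one (fun y => σ * V y) ε y

/-! ## §2 The cascade instance -/

section Cascade

variable (P : CascadeParams)

/-- **Flat-strip data of the cascade, family `σ = +1`.**  Phase `j` (`0 < δ_j`, `N_j ≠ 0`), `0 < ε ≤ 2/9`; `Ũ_j` the affine
profile of `…AffineProfileCascade` with threshold `3ε` packaged as the profile `Ut` (pointwise), `Q = amp Ut γ` the exact-flat
un-gauging profile, `X⁺_j(y) = sT((U_j′(y) − (1−2ε))/ε)` packaged as the profile `X`.  Then on `U = {U_j′ > 1 − 3ε}`: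
`Q′ = γ`; off `U` the cut-off vanishes locally; `|X| ≤ 1`. [cite: Grafakos2014, Prop. 3.1.2 (5)] -/
theorem cascade_flatStrip_data_pos {j : ℕ} (hδj : 0 < P.δ j) (hN : P.N j ≠ 0) {ε : ℝ} (hε : 0 < ε) (hε' : ε ≤ 2 / 9)
    (Ut : ShearProfile) (hUt : ∀ y, Ut y = P.U j y + ∫ t in (0 : ℝ)..y, ((1 - deriv (P.U j) t) *
        smoothTransition ((deriv (P.U j) t - (1 - 2 * (3 * ε))) / (3 * ε)) +
      (-1 - deriv (P.U j) t) * smoothTransition ((-deriv (P.U j) t - (1 - 2 * (3 * ε))) / (3 * ε))))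
    (X : ShearProfile) (hX : ∀ y, X y = smoothTransition ((deriv (P.U j) y - (1 - 2 * ε)) / ε)) :
    (∀ y ∈ {y : ℝ | 1 - 3 * ε < deriv (P.U j) y}, HasDerivAt (amp Ut P.γ) (P.γ * 1) y) ∧
      (∀ y, y ∉ {y : ℝ | 1 - 3 * ε < deriv (P.U j) y} → (fun y : ℝ => (X y : ℂ)) =ᶠ[𝓝 y] 0) ∧ (∀ y, |X y| ≤ 1) := by
  have h3ε : 0 < 3 * ε := by positivity
  have h3ε' : 3 * ε ≤ 2 / 3 := by linarith
  have hUtf : (Ut : ℝ → ℝ) = fun y => P.U j y + ∫ t in (0 : ℝ)..y, ((1 - deriv (P.U j) t) *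
        smoothTransition ((deriv (P.U j) t - (1 - 2 * (3 * ε))) / (3 * ε)) +
      (-1 - deriv (P.U j) t) * smoothTransition ((-deriv (P.U j) t - (1 - 2 * (3 * ε))) / (3 * ε))) := funext hUt
  have hslope : ∀ y, 1 - 3 * ε ≤ (1 : ℝ) * deriv (P.U j) y → HasDerivAt Ut 1 y := fun y hy => by
    rw [one_mul] at hy
    have h := hasDerivAt_affinizeU_of_ge P h3ε h3ε' hδj hN hy
    rwa [← hUtf] at h
  have h := flatStrip_data (P.contDiff_deriv_U hδj (n := 0)).continuous (σ := 1) hε (by linarith) hslope P.γ (amp Ut P.γ)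
    (fun y => by rw [amp_apply]) X (fun y => by rw [hX, one_mul])
  simpa only [one_mul] using h

/-- **Flat-strip data of the cascade, family `σ = −1`** (as `cascade_flatStrip_data_pos` with `X⁻_j(y) = sT((−U_j′(y) − (1−2ε))/ε)`,
`U = {−U_j′ > 1 − 3ε}`, slope `−γ`). [cite: Grafakos2014, Prop. 3.1.2 (5)] -/
theorem cascade_flatStrip_data_neg {j : ℕ} (hδj : 0 < P.δ j) (hN : P.N j ≠ 0) {ε : ℝ} (hε : 0 < ε) (hε' : ε ≤ 2 / 9)
    (Ut : ShearProfile) (hUt : ∀ y, Ut y = P.U j y + ∫ t in (0 : ℝ)..y, ((1 - deriv (P.U j) t) *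
        smoothTransition ((deriv (P.U j) t - (1 - 2 * (3 * ε))) / (3 * ε)) +
      (-1 - deriv (P.U j) t) * smoothTransition ((-deriv (P.U j) t - (1 - 2 * (3 * ε))) / (3 * ε))))
    (X : ShearProfile) (hX : ∀ y, X y = smoothTransition ((-deriv (P.U j) y - (1 - 2 * ε)) / ε)) :
    (∀ y ∈ {y : ℝ | 1 - 3 * ε < -deriv (P.U j) y}, HasDerivAt (amp Ut P.γ) (P.γ * (-1)) y) ∧
      (∀ y, y ∉ {y : ℝ | 1 - 3 * ε < -deriv (P.U j) y} → (fun y : ℝ => (X y : ℂ)) =ᶠ[𝓝 y] 0) ∧ (∀ y, |X y| ≤ 1) := by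
  have h3ε : 0 < 3 * ε := by positivity
  have h3ε' : 3 * ε ≤ 2 / 3 := by linarith
  have hUtf : (Ut : ℝ → ℝ) = fun y => P.U j y + ∫ t in (0 : ℝ)..y, ((1 - deriv (P.U j) t) *
        smoothTransition ((deriv (P.U j) t - (1 - 2 * (3 * ε))) / (3 * ε)) +
      (-1 - deriv (P.U j) t) * smoothTransition ((-deriv (P.U j) t - (1 - 2 * (3 * ε))) / (3 * ε))) := funext hUt
  have hslope : ∀ y, 1 - 3 * ε ≤ (-1 : ℝ) * deriv (P.U j) y → HasDerivAt Ut (-1) y := fun y hy => by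
    have hy' : deriv (P.U j) y ≤ -(1 - 3 * ε) := by linarith
    have h := hasDerivAt_affinizeU_of_le P h3ε h3ε' hδj hN hy'
    rwa [← hUtf] at h
  have h := flatStrip_data (P.contDiff_deriv_U hδj (n := 0)).continuous (σ := -1) hε (by linarith) hslope P.γ (amp Ut P.γ)
    (fun y => by rw [amp_apply]) X (fun y => by rw [hX, neg_one_mul])
  simpa only [neg_one_mul] using h

end Cascade

end Summit.AnomalousDissipation.AnomalousDissipation.Theorems.SawtoothPulseCascade.K1Ledger
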